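import Literature.NumberTheory.EllipticCurves.TorsionConductorExponentAdditiveProofs
import Literature.NumberTheory.EllipticCurves.InertiaFixedTorsionTypeIVProofs
import HarnessLib

/-!
# The Serre conductor exponent of `E[3]` at a place `v ∤ 6` of Kodaira type `IV` or `IV*` is `1`
# — the conductor drop `a_v(E[3]) = f_v(E) − 1` WITHOUT the hypothesis `3 ∣ c_v` (theorems only)

`Proofs` file (theorems only: no definition, no named fact, no instance), topic
`NumberTheory/EllipticCurves`; sequel of `TorsionConductorExponentAdditiveProofs` (there: `a_v(E[3]) = 1`
at an additive `v ∤ 6` with `3 ∣ c_v`) and `InertiaFixedTorsionTypeIVProofs` (at a place `v ∤ 3` of type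
`IV`/`IV*` the inertia invariants `E[3]^{I_v}` are EXACTLY a line, whatever `c_v`).  Combining them:

* `WeierstrassCurve.natCard_fixedSubmodule_inertia_primeBelow_torsion_three_of_kodairaSymbolAt`,
  `…finrank_…`, `…codimFixed_inertia_torsion_three_eq_one_of_kodairaSymbolAt` — at `v ∤ 3` of type
  `IV`/`IV*`: `#E[3]^{I_𝔓} = 3`, `dim = 1`, **`codim E[3]^{I_𝔓} = 1` at every `𝔓 ∣ v`**;
* `WeierstrassCurve.artinConductorAt_torsion_three_eq_one_of_isTameAt_of_kodairaSymbolAt` — `a_𝔓(E[3]) = 1`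
  modulo tameness (covers `v ∣ 2`);
* **`WeierstrassCurve.artinConductorExponent_torsion_three_eq_one_of_kodairaSymbolAt`** — UNCONDITIONAL at
  `v ∤ 6`: `a_v(E[3]) = 1`; **`…_add_one_eq_conductorExponent_of_kodairaSymbolAt`**: `a_v(E[3]) + 1 = f_v(E)
  = 2` — Darmon–Diamond–Taylor's recipe `m_v(ρ̄) = f_v(E) − dim E[3]^{I_v}` with
  `E[3]^{I_v} ≅ Φ_v(k̄)[3] ≅ ℤ/3` at the types `IV`, `IV*`, now including the cell `c_v = 1` (the Step-5/8
  quadratic irreducible over `k_v`; Frobenius acts by `−1` on the fixed line).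

With `Theorems.ShadowConductor.artinConductorExponent_torsion_three_eq_conductorExponent_of_ne_IV` (types
`≠ IV, IV*`: exponent kept) this completes the `p = 3` table at every additive place `v ∤ 6`:
**`a_v(E[3]) = f_v(E) − [type ∈ {IV, IV*}]`**.  Consumer (cell `bsd-ssimc`, crux `KobayashiLowerHalfLargeImage`,
stmt-BirchSwinnertonDyer-19001, line `shadow_seed`): `q ∥ N(ρ̄_{E,3})` at EVERY shadow prime `q ≥ 5`, both
branches `c_q = 3` (`q ≡ 2 (mod 3)`) and `c_q = 1` (`q ≡ 1 (mod 3)`).  Nothing is asserted about any curve;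
BSD is not proved by any of this.

## References

* [SerreLocalFields1979] J.-P. Serre, *Local Fields* (1979), Ch. VI §§2–3.
* [Serre1987] J.-P. Serre, Duke Math. J. 54 (1987), §1.2 (the level `N(ρ)`).
* [DarmonDiamondTaylor1995] H. Darmon, F. Diamond, R. Taylor, *Fermat's Last Theorem*, CDM 1995, §2.1
  (p. 54), Lemma 2.7, Remark 2.14.
* [SilvermanATAEC1994] J. H. Silverman, *Advanced Topics* (1994), §IV.10, Thm. IV.10.2, Table 4.1.
* [SilvermanAEC2009] J. H. Silverman, *The Arithmetic of Elliptic Curves*, 2nd ed. (2009), Thm. VII.6.1.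

## Design

No definitions; one universe `u`; the local instance `AddSubgroup.torsionBy.zmodModule` is Mathlib's
`ZMod n`-module structure on `A[n]`, the one carried by the type of `torsionGaloisRep` (as in
`SwanConductorTorsionProofs` and `TorsionConductorExponentAdditiveProofs`); it overrides nothing.
Axioms: `propext`, `Classical.choice`, `Quot.sound`.
-/

noncomputable section

open scoped Classical NumberField Pointwise
open Field IsDedekindDomain IsDedekindDomain.HeightOneSpectrum NumberField

attribute [local instance] AddSubgroup.torsionBy.zmodModule

universe u

namespace WeierstrassCurve

open Literature.NumberTheory.EllipticCurves Literature.NumberTheory.GaloisRepresentations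
  Literature.NumberTheory.DiophantineGeometry

variable {K : Type u} [Field K] [NumberField K] (W : WeierstrassCurve K) {v : HeightOneSpectrum (𝓞 K)}

/-! ### From an inertia-fixed line to the conductor exponent (shared plumbing) -/

/-- If the points of `E[3]` fixed by the local inertia group `absInertia K_v` form a subgroup `A` of
exactly `3` elements (maximal among inertia-fixed `3`-torsion), then `#E[3]^{I_𝔓} = 3` for the prime
`𝔓 = 𝔓_{ι₀,𝔐}` cut out by the chosen embedding (`mem_fixedSubmodule_inertia_primeBelow_iff`,
`inertia_eq_absInertia`); private plumbing shared by the `c_v`- and the Kodaira-keyed statements. [folklore] -/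
private theorem natCard_fixedSubmodule_inertia_primeBelow_torsion_three_of_line
    {𝔐 : Ideal (localAbsIntegers v)} (h𝔐 : 𝔐 ∈ v.localPrimesAbove)
    (hline : ∃ A : AddSubgroup (geomPoints W), A ≤ geomTorsion W (3 : ℤ) ∧ Nat.card A = 3 ∧
      (∀ σ ∈ absInertia (v.adicCompletion K), ∀ P ∈ A,
        absGaloisRestrict K (v.adicCompletion K) σ • P = P) ∧
      ∀ P ∈ geomTorsion W (3 : ℤ), (∀ σ ∈ absInertia (v.adicCompletion K),
        absGaloisRestrict K (v.adicCompletion K) σ • P = P) → P ∈ A) :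
    Nat.card ((W.torsionGaloisRep 3).fixedSubmodule
        ((v.primeBelow (closureEmb (K := K) (v.adicCompletion K)) 𝔐).inertia
          (absoluteGaloisGroup K))) = 3 := by
  obtain ⟨w, hw⟩ := v.exists_spectralValuation
  obtain ⟨A, hA3, hAcard, hAI, hAmax⟩ := hline
  have hIeq : 𝔐.inertia (absoluteGaloisGroup (v.adicCompletion K)) =
      absInertia (v.adicCompletion K) := inertia_eq_absInertia hw h𝔐
  set F := (W.torsionGaloisRep 3).fixedSubmodule
    ((v.primeBelow (closureEmb (K := K) (v.adicCompletion K)) 𝔐).inertia (absoluteGaloisGroup K))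
    with hFdef
  have key : ∀ P : geomTorsion W ((3 : ℕ) : ℤ), P ∈ F ↔ (P : geomPoints W) ∈ A := by
    intro P
    rw [hFdef, W.mem_fixedSubmodule_inertia_primeBelow_iff h𝔐, hIeq]
    exact ⟨fun h ↦ hAmax _ P.2 h, fun hP σ hσ ↦ hAI σ hσ _ hP⟩
  have e : F ≃ A :=
    { toFun := fun P ↦ ⟨(P.1 : geomPoints W), (key P.1).mp P.2⟩
      invFun := fun a ↦ ⟨⟨(a : geomPoints W), hA3 a.2⟩, (key _).mpr a.2⟩
      left_inv := fun P ↦ rfl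
      right_inv := fun a ↦ rfl }
  rw [Nat.card_congr e, hAcard]

/-! ### The Kodaira-keyed statements -/

/-- **`#E[3]^{I_𝔓} = 3` at a place `v ∤ 3` of Kodaira type `IV` or `IV*`** (for `𝔓 = 𝔓_{ι₀,𝔐}`), from
the line of `exists_line_geomTorsion_three_absInertia_fixed_of_kodairaSymbolAt` (no hypothesis on `c_v`).
[cite: SilvermanAEC2009, Thm. VII.6.1 (PDF p. 177)] [cite: SilvermanATAEC1994, Cor. IV.9.2(d) with Table 4.1 (PDF pp. 340, 365)] -/
theorem natCard_fixedSubmodule_inertia_primeBelow_torsion_three_of_kodairaSymbolAt [W.IsElliptic]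
    (h3v : (3 : 𝓞 K) ∉ v.asIdeal) (hT : W.kodairaSymbolAt v = .IV ∨ W.kodairaSymbolAt v = .IVstar)
    {𝔐 : Ideal (localAbsIntegers v)} (h𝔐 : 𝔐 ∈ v.localPrimesAbove) :
    Nat.card ((W.torsionGaloisRep 3).fixedSubmodule
        ((v.primeBelow (closureEmb (K := K) (v.adicCompletion K)) 𝔐).inertia
          (absoluteGaloisGroup K))) = 3 :=
  W.natCard_fixedSubmodule_inertia_primeBelow_torsion_three_of_line h𝔐
    (W.exists_line_geomTorsion_three_absInertia_fixed_of_kodairaSymbolAt h3v hT)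

/-- **`dim_{𝔽₃} E[3]^{I_𝔓} = 1`** at a place `v ∤ 3` of type `IV` or `IV*` (`𝔓 = 𝔓_{ι₀,𝔐}`).
[cite: SilvermanAEC2009, Thm. VII.6.1 (PDF p. 177)] [cite: SilvermanATAEC1994, Cor. IV.9.2(d) with Table 4.1 (PDF pp. 340, 365)] -/
theorem finrank_fixedSubmodule_inertia_primeBelow_torsion_three_of_kodairaSymbolAt [W.IsElliptic]
    (h3v : (3 : 𝓞 K) ∉ v.asIdeal) (hT : W.kodairaSymbolAt v = .IV ∨ W.kodairaSymbolAt v = .IVstar)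
    {𝔐 : Ideal (localAbsIntegers v)} (h𝔐 : 𝔐 ∈ v.localPrimesAbove) :
    Module.finrank (ZMod 3) ((W.torsionGaloisRep 3).fixedSubmodule
        ((v.primeBelow (closureEmb (K := K) (v.adicCompletion K)) 𝔐).inertia
          (absoluteGaloisGroup K))) = 1 := by
  haveI : Fact (Nat.Prime 3) := ⟨Nat.prime_three⟩
  set F := (W.torsionGaloisRep 3).fixedSubmodule
    ((v.primeBelow (closureEmb (K := K) (v.adicCompletion K)) 𝔐).inertia (absoluteGaloisGroup K))
    with hFdef
  have hcard : Nat.card F = 3 :=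
    W.natCard_fixedSubmodule_inertia_primeBelow_torsion_three_of_kodairaSymbolAt h3v hT h𝔐
  haveI : Finite F := Nat.finite_of_card_ne_zero (by rw [hcard]; norm_num)
  haveI : Module.Finite (ZMod 3) F := Module.Finite.of_finite
  have h := Module.natCard_eq_pow_finrank (K := ZMod 3) (V := F)
  rw [hcard, Nat.card_zmod] at h
  have h1 : (3 : ℕ) ^ 1 = 3 ^ Module.finrank (ZMod 3) F := by rw [pow_one]; exact h
  exact (Nat.pow_right_injective (a := 3) (by norm_num) h1).symm

/-- **`codim E[3]^{I_𝔓} = 1` at EVERY prime `𝔓 ∣ v` of a place `v ∤ 3` of Kodaira type `IV` or `IV*`**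
(`dim E[3] = 2`, `dim E[3]^{I_𝔓} = 1` at `𝔓_{ι₀,𝔐}`, conjugation for the other primes:
`exists_smul_eq_of_mem_primesAbove_holds`, `Ideal.inertia_smul`, `ContinuousRep.codimFixed_conj_smul`).
[cite: SerreLocalFields1979, Ch. VI §2 Cor. 1' and §3 (globalisation)] [cite: SilvermanAEC2009, Thm. VII.6.1 (PDF p. 177)] -/
theorem codimFixed_inertia_torsion_three_eq_one_of_kodairaSymbolAt [W.IsElliptic]
    (h3v : (3 : 𝓞 K) ∉ v.asIdeal) (hT : W.kodairaSymbolAt v = .IV ∨ W.kodairaSymbolAt v = .IVstar)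
    {𝔓 : Ideal (absIntegers (𝓞 K) K)} (h𝔓 : 𝔓 ∈ v.primesAbove) :
    (W.torsionGaloisRep 3).codimFixed (𝔓.inertia (absoluteGaloisGroup K)) = 1 := by
  haveI : Fact (Nat.Prime 3) := ⟨Nat.prime_three⟩
  obtain ⟨𝔐, h𝔐⟩ := v.localPrimesAbove_nonempty
  have h𝔓₁ : v.primeBelow (closureEmb (K := K) (v.adicCompletion K)) 𝔐 ∈ v.primesAbove :=
    primeBelow_mem_primesAbove h𝔐
  obtain ⟨g, hg⟩ := HeightOneSpectrum.exists_smul_eq_of_mem_primesAbove_holds h𝔓₁ h𝔓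
  rw [← hg, Ideal.inertia_smul, ContinuousRep.codimFixed_conj_smul]
  haveI : Finite (geomTorsion W ((3 : ℕ) : ℤ)) := W.finite_geomTorsion_nat (by norm_num)
  haveI : Module.Finite (ZMod 3) (geomTorsion W ((3 : ℕ) : ℤ)) := Module.Finite.of_finite
  have h2 : Module.finrank (ZMod 3) (geomTorsion W ((3 : ℕ) : ℤ)) = 2 :=
    W.finrank_geomTorsion_eq_two 3 (by norm_num)
  have h1 := W.finrank_fixedSubmodule_inertia_primeBelow_torsion_three_of_kodairaSymbolAt h3v hT h𝔐
  have h := ContinuousRep.codimFixed_eq_finrank_sub (W.torsionGaloisRep 3)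
    ((v.primeBelow (closureEmb (K := K) (v.adicCompletion K)) 𝔐).inertia (absoluteGaloisGroup K))
  rw [h2] at h
  rw [h]
  change 2 - Module.finrank (ZMod 3) ((W.torsionGaloisRep 3).fixedSubmodule _) = 1
  rw [h1]

/-- **`a_𝔓(E[3]) = 1` at a place `v ∤ 3` of type `IV` or `IV*`, granted tameness of `E[3]` at `𝔓`**
(`a_𝔓 = codim + Sw = 1 + 0`; covers `v ∣ 2`, where tameness is the clause `f_2 = 2`).
[cite: SerreLocalFields1979, Ch. VI §2, Cor. 1'] [cite: Serre1987, §1.2 (definition of N(ρ))] -/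
theorem artinConductorAt_torsion_three_eq_one_of_isTameAt_of_kodairaSymbolAt [W.IsElliptic]
    (h3v : (3 : 𝓞 K) ∉ v.asIdeal) (hT : W.kodairaSymbolAt v = .IV ∨ W.kodairaSymbolAt v = .IVstar)
    {𝔓 : Ideal (absIntegers (𝓞 K) K)} (h𝔓 : 𝔓 ∈ v.primesAbove)
    (htame : (W.torsionGaloisRep 3).IsTameAt (𝓞 K) 𝔓) :
    (W.torsionGaloisRep 3).artinConductorAt (𝓞 K) 𝔓 = 1 := by
  haveI : Fact (Nat.Prime 3) := ⟨Nat.prime_three⟩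
  rw [GaloisRep.artinConductorAt_def, htame.swanConductorAt_eq_zero, add_zero]
  change (((W.torsionGaloisRep 3).codimFixed (𝔓.inertia (absoluteGaloisGroup K)) : ℕ) : ℝ) = 1
  rw [W.codimFixed_inertia_torsion_three_eq_one_of_kodairaSymbolAt h3v hT h𝔓, Nat.cast_one]

/-- **`a_v(E[3]) = 1` at a place `v ∤ 3` of type `IV` or `IV*`, granted tameness at one `𝔓 ∣ v`.**
[cite: SerreLocalFields1979, Ch. VI §3 (the exponent f(χ, 𝔭))] [cite: Serre1987, §1.2 (definition of N(ρ))] -/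
theorem artinConductorExponent_torsion_three_eq_one_of_isTameAt_of_kodairaSymbolAt [W.IsElliptic]
    (h3v : (3 : 𝓞 K) ∉ v.asIdeal) (hT : W.kodairaSymbolAt v = .IV ∨ W.kodairaSymbolAt v = .IVstar)
    {𝔓 : Ideal (absIntegers (𝓞 K) K)} (h𝔓 : 𝔓 ∈ v.primesAbove)
    (htame : (W.torsionGaloisRep 3).IsTameAt (𝓞 K) 𝔓) :
    (W.torsionGaloisRep 3).artinConductorExponent v = 1 := by
  have h0 := (primesAbove_nonempty v).some_mem
  unfold GaloisRep.artinConductorExponent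
  rw [GaloisRep.artinConductorAt_eq_of_mem_primesAbove_holds h0 h𝔓 (W.torsionGaloisRep 3),
    W.artinConductorAt_torsion_three_eq_one_of_isTameAt_of_kodairaSymbolAt h3v hT h𝔓 htame,
    Nat.floor_one]

/-- **The conductor drop at every place of type `IV` or `IV*`, unconditionally: `a_v(E[3]) = 1` at
`v ∤ 6`** — for an elliptic curve `E/K` over a number field and a finite place `v` with `2, 3 ∉ v` of
Kodaira type `IV` or `IV*` (potentially good, tame, `#Φ_v(k̄) = 3`; NO hypothesis on the rational
Tamagawa number `c_v ∈ {1, 3}`), the Serre conductor exponent of `E[3]` at `v` is `1`.  Over `ℚ`: `q ∥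
N(ρ̄_{E,3})` at every shadow prime `q ≥ 5` of line `shadow_seed`, both branches `q ≡ ±1 (mod 3)`.
Tameness from `isTameAt_torsionGaloisRep_of_notMem_two_three`.
[cite: DarmonDiamondTaylor1995, §2.1 (p. 54), Lemma 2.7 and Remark 2.14] [cite: Serre1987, §1.2 (definition of N(ρ))]
[cite: SilvermanATAEC1994, Thm. IV.10.2(b) (PDF pp. 358–362) and Table 4.1 (p. 365)] -/
theorem artinConductorExponent_torsion_three_eq_one_of_kodairaSymbolAt [W.IsElliptic]
    (h2 : (2 : 𝓞 K) ∉ v.asIdeal) (h3 : (3 : 𝓞 K) ∉ v.asIdeal)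
    (hT : W.kodairaSymbolAt v = .IV ∨ W.kodairaSymbolAt v = .IVstar) :
    (W.torsionGaloisRep 3).artinConductorExponent v = 1 := by
  haveI : Fact (Nat.Prime 3) := ⟨Nat.prime_three⟩
  obtain ⟨𝔓, h𝔓⟩ := primesAbove_nonempty v
  exact W.artinConductorExponent_torsion_three_eq_one_of_isTameAt_of_kodairaSymbolAt h3 hT h𝔓
    (W.isTameAt_torsionGaloisRep_of_notMem_two_three 3 (by exact_mod_cast h3) h2 h3 h𝔓)

/-- **`a_v(E[3]) + 1 = f_v(E)` at a place `v ∤ 6` of type `IV` or `IV*`** (the DROP displayed: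
`a_v(E[3]) = 1`, `f_v(E) = ε_v = 2` by `conductorExponent_eq_tameConductorExponent_holds` at an additive
type).  Darmon–Diamond–Taylor Lemma 2.7's recipe at the types `IV`, `IV*`, all `c_v`.
[cite: DarmonDiamondTaylor1995, Lemma 2.7 and Remark 2.14] [cite: SilvermanATAEC1994, Thm. IV.10.2 and IV.10.4 (PDF pp. 358–362)] -/
theorem artinConductorExponent_torsion_three_add_one_eq_conductorExponent_of_kodairaSymbolAt
    [W.IsElliptic] (h2 : (2 : 𝓞 K) ∉ v.asIdeal) (h3 : (3 : 𝓞 K) ∉ v.asIdeal)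
    (hT : W.kodairaSymbolAt v = .IV ∨ W.kodairaSymbolAt v = .IVstar) :
    (W.torsionGaloisRep 3).artinConductorExponent v + 1 = W.conductorExponent v := by
  haveI : PerfectField (IsLocalRing.ResidueField (v.adicCompletionIntegers K)) :=
    PerfectField.ofFinite
  have hk : (W.kodairaSymbolAt v).IsAdditive := by rcases hT with h | h <;> rw [h] <;> decide
  rw [W.artinConductorExponent_torsion_three_eq_one_of_kodairaSymbolAt h2 h3 hT,
    conductorExponent_eq_tameConductorExponent_holds v W
      (v.ringChar_ne_of_natCast_notMem (p := 2) (by exact_mod_cast h2))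
      (v.ringChar_ne_of_natCast_notMem (p := 3) (by exact_mod_cast h3)),
    (KodairaSymbol.tameConductorExponent_eq_two_iff _).mpr hk]

end WeierstrassCurve

end
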